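import Summits.SmoothPoincare4.SmoothPoincare4.Theorems.CylinderEntropySliceIsolationStubSeparationPersistsAux6
import Summits.SmoothPoincare4.SmoothPoincare4.Theorems.CylinderEntropySliceIsolationStubSeparationPersistsAux3
import HarnessLib

/-!
# End-separation persists along a cylinder flow, part 7: end-separation — bookkeeping and the closed half

Part of the proof of the stub `stub_separationPersists` (END-SEPARATION PERSISTS ALONG A CYLINDER
FLOW) of line `conformal-kernel-domination` (closing chain γ) of the crux `CylinderEntropy.SliceIsolation`
(stmt-SmoothPoincare4-7632); see `CylinderEntropySliceIsolationStubSeparationPersists.lean` for the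
overall argument. Everything here is proved (no named facts).

* `joinedIn_far`, `not_joinedIn_of_separatesEnds`, `separatesEnds_of_not_joinedIn` — the far regions
  `{z₅ < -B}`, `{z₅ > B}` of `N` are path connected off a cross-section of heights in `[-B, B]`
  (vertical segments and horizontal paths in the sphere slices), so `SeparatesEnds` may be tested
  with any radius `R > B`, or on two reference far points;
* `cylFlow_isClosed_separatesEnds` — **the set of separating times is closed**: a path joining the
  ends off `F t (M)` is compact, at positive distance from the compact slice, hence misses the
  uniformly close slices `F tₙ (M)`.

## References

* M. W. Hirsch, *Differential Topology*, GTM 33 (1976), Ch. 4 §5 (tubular neighbourhoods), Ch. 8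
  Thm. 1.3 (isotopy extension). [HirschDT1976]
* A. Hatcher, *Algebraic Topology*, CUP (2002), Prop. 3.46 (Jordan–Brouwer separation via Alexander
  duality). [HatcherAT2002]
-/

set_option linter.dupNamespace false

noncomputable section

open MeasureTheory Set Function Filter Module Asymptotics Metric
open scoped Manifold ContDiff ENNReal Topology RealInnerProductSpace NNReal

namespace Summit.SmoothPoincare4.SmoothPoincare4.Theorems.CylinderEntropySliceIsolation

open Summit.SmoothPoincare4.SmoothPoincare4.Theorems.CylinderRungTwo.KillingFlux
open Literature.Geometry.Riemannian
open Literature.Geometry.Lorentzian Literature.Geometry.Lorentzian.PseudoRiemannianMetric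
open Literature.Geometry.Riemannian.SphericalCylinderEntropy (truncL truncL_apply lipschitz_truncL)
open Literature.Geometry.Manifold.CylinderSlice (axis castSucc_ne_five padL padL_apply_castSucc
  padL_apply_last)

-- ===== PART 4 =====

/-! ## Part 4: end-separation — bookkeeping, the closed half, the open half, assembly -/

section Ends

open Summit.SmoothPoincare4.SmoothPoincare4.Cruxes.CylinderRungTwo.KillingFlux (IsCylinderMCF SeparatesEnds cylN)

/-- **Horizontal paths**: two points of `N` at the same height `c` are joined inside the sphere
slice `{z ∈ N | z₅ = c}` (`S⁴` is path connected). [folklore] -/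
theorem joinedIn_horizontal {p q : EuclideanSpace ℝ (Fin 5)} (hp : ∑ i : Fin 5, p i ^ 2 = 1)
    (hq : ∑ i : Fin 5, q i ^ 2 = 1) (c : ℝ) :
    JoinedIn {z : EuclideanSpace ℝ (Fin 6) | ∑ i : Fin 5, z (Fin.castSucc i) ^ 2 = 1 ∧ z 5 = c}
      (padL p + c • (axis : EuclideanSpace ℝ (Fin 6))) (padL q + c • (axis : EuclideanSpace ℝ (Fin 6))) := by
  have hS : IsPathConnected (Metric.sphere (0 : EuclideanSpace ℝ (Fin 5)) 1) := by
    refine isPathConnected_sphere ?_ 0 zero_le_one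
    rw [← Module.finrank_eq_rank, finrank_euclideanSpace_fin]
    exact_mod_cast (by norm_num : (1 : ℕ) < 5)
  have hp' : p ∈ Metric.sphere (0 : EuclideanSpace ℝ (Fin 5)) 1 := by
    rw [mem_sphere_zero_iff_norm, EuclideanSpace.norm_eq, Real.sqrt_eq_one]
    simpa [Real.norm_eq_abs, sq_abs] using hp
  have hq' : q ∈ Metric.sphere (0 : EuclideanSpace ℝ (Fin 5)) 1 := by
    rw [mem_sphere_zero_iff_norm, EuclideanSpace.norm_eq, Real.sqrt_eq_one]
    simpa [Real.norm_eq_abs, sq_abs] using hq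
  have hf : Continuous fun y : EuclideanSpace ℝ (Fin 5) => padL y + c • (axis : EuclideanSpace ℝ (Fin 6)) := by fun_prop
  refine ((hS.joinedIn p hp' q hq').map hf).mono ?_
  rintro _ ⟨y, hy, rfl⟩
  have hy1 : ∑ i : Fin 5, y i ^ 2 = 1 := sum_sq_of_norm_eq_one (by simpa using hy)
  exact ⟨vert_mem_Ncyl hy1 c, vert_apply_five y c⟩

/-- **The far regions are path connected off a bounded cross-section.** If `|z₅| ≤ B` on `A ⊆ ℝ⁶`
then two points of `N` of heights `< -B` are joined in `N ∖ A`, and so are two points of heights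
`> B` (a vertical segment followed by a horizontal path). [folklore] -/
theorem joinedIn_far {A : Set (EuclideanSpace ℝ (Fin 6))} {B : ℝ} (hA : ∀ z ∈ A, |z 5| ≤ B)
    {a a' : EuclideanSpace ℝ (Fin 6)} (ha : ∑ i : Fin 5, a (Fin.castSucc i) ^ 2 = 1)
    (ha' : ∑ i : Fin 5, a' (Fin.castSucc i) ^ 2 = 1)
    (hh : (a 5 < -B ∧ a' 5 < -B) ∨ (B < a 5 ∧ B < a' 5)) :
    JoinedIn (({z : EuclideanSpace ℝ (Fin 6) | ∑ i : Fin 5, z (Fin.castSucc i) ^ 2 = 1} :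
        Set (EuclideanSpace ℝ (Fin 6))) \ A) a a' := by
  have htr : ∀ {w : EuclideanSpace ℝ (Fin 6)}, ∑ i : Fin 5, w (Fin.castSucc i) ^ 2 = 1 →
      ∑ i : Fin 5, (truncL w) i ^ 2 = 1 := fun hw => by simpa [truncL_apply] using hw
  -- heights in the far regions are off `A`
  have hoff : ∀ w : EuclideanSpace ℝ (Fin 6), (w 5 < -B ∨ B < w 5) → w ∉ A := by
    rintro w hw hwA
    have := hA w hwA
    rw [abs_le] at this
    rcases hw with hw | hw <;> linarith
  -- vertical move from `a` to height `a' 5`, then horizontal move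
  have h1 : JoinedIn (({z : EuclideanSpace ℝ (Fin 6) | ∑ i : Fin 5, z (Fin.castSucc i) ^ 2 = 1} :
      Set (EuclideanSpace ℝ (Fin 6))) \ A) a (padL (truncL a) + a' 5 • (axis : EuclideanSpace ℝ (Fin 6))) := by
    conv_lhs => rw [eq_vert a]
    refine (joinedIn_vert (ι := fun z : A => (z : EuclideanSpace ℝ (Fin 6))) (htr ha) fun s hs hmem => ?_).mono ?_
    · obtain ⟨⟨w, hwA⟩, hw⟩ := hmem
      refine hoff w ?_ hwA
      have hw5 : w 5 = s := by
        have h5 := congrArg (fun v : EuclideanSpace ℝ (Fin 6) => v 5) hw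
        simp only [vert_apply_five] at h5
        exact h5
      rw [hw5]
      rcases hh with ⟨h₁, h₂⟩ | ⟨h₁, h₂⟩
      · left
        rcases le_total (a 5) (a' 5) with hle | hle
        · rw [Set.uIcc_of_le hle] at hs; linarith [hs.2]
        · rw [Set.uIcc_of_ge hle] at hs; linarith [hs.2]
      · right
        rcases le_total (a 5) (a' 5) with hle | hle
        · rw [Set.uIcc_of_le hle] at hs; linarith [hs.1]
        · rw [Set.uIcc_of_ge hle] at hs; linarith [hs.1]
    · rintro w ⟨hwN, hwr⟩
      exact ⟨hwN, fun hwA => hwr ⟨⟨w, hwA⟩, rfl⟩⟩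
  have h2 : JoinedIn (({z : EuclideanSpace ℝ (Fin 6) | ∑ i : Fin 5, z (Fin.castSucc i) ^ 2 = 1} :
      Set (EuclideanSpace ℝ (Fin 6))) \ A) (padL (truncL a) + a' 5 • (axis : EuclideanSpace ℝ (Fin 6))) a' := by
    conv_rhs => rw [eq_vert a']
    refine (joinedIn_horizontal (htr ha) (htr ha') (a' 5)).mono ?_
    rintro w ⟨hwN, hw5⟩
    refine ⟨hwN, hoff w ?_⟩
    rw [hw5]
    rcases hh with ⟨-, h₂⟩ | ⟨-, h₂⟩
    · exact Or.inl h₂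
    · exact Or.inr h₂
  exact h1.trans h2

/-- **End-separation with an explicit radius.** If `|z₅| ≤ B` on `A` and `A` separates the ends
of `N` (for SOME radius), then it does so for EVERY radius `R > B`: no path in `N ∖ A` from height
`≤ -R` to height `≥ R` (slide the endpoints vertically and horizontally in the far regions).
[folklore] -/
theorem not_joinedIn_of_separatesEnds {A : Set (EuclideanSpace ℝ (Fin 6))} {B : ℝ} (hA : ∀ z ∈ A, |z 5| ≤ B)
    (hsep : SeparatesEnds A) {R : ℝ} (hR : B < R) {a b : EuclideanSpace ℝ (Fin 6)}
    (ha : ∑ i : Fin 5, a (Fin.castSucc i) ^ 2 = 1) (hb : ∑ i : Fin 5, b (Fin.castSucc i) ^ 2 = 1)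
    (ha5 : a 5 ≤ -R) (hb5 : R ≤ b 5) :
    ¬ JoinedIn (({z : EuclideanSpace ℝ (Fin 6) | ∑ i : Fin 5, z (Fin.castSucc i) ^ 2 = 1} :
        Set (EuclideanSpace ℝ (Fin 6))) \ A) a b := by
  intro hJ
  obtain ⟨R₀, hR₀⟩ := hsep
  set R' : ℝ := max R R₀ with hR'
  have htr : ∀ {w : EuclideanSpace ℝ (Fin 6)}, ∑ i : Fin 5, w (Fin.castSucc i) ^ 2 = 1 →
      ∑ i : Fin 5, (truncL w) i ^ 2 = 1 := fun hw => by simpa [truncL_apply] using hw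
  set a' : EuclideanSpace ℝ (Fin 6) := padL (truncL a) + (-R') • (axis : EuclideanSpace ℝ (Fin 6)) with ha'
  set b' : EuclideanSpace ℝ (Fin 6) := padL (truncL b) + R' • (axis : EuclideanSpace ℝ (Fin 6)) with hb'
  have ha'N : ∑ i : Fin 5, a' (Fin.castSucc i) ^ 2 = 1 := vert_mem_Ncyl (htr ha) _
  have hb'N : ∑ i : Fin 5, b' (Fin.castSucc i) ^ 2 = 1 := vert_mem_Ncyl (htr hb) _
  have ha'5 : a' 5 = -R' := vert_apply_five _ _
  have hb'5 : b' 5 = R' := vert_apply_five _ _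
  have h1 : JoinedIn (({z : EuclideanSpace ℝ (Fin 6) | ∑ i : Fin 5, z (Fin.castSucc i) ^ 2 = 1} :
      Set (EuclideanSpace ℝ (Fin 6))) \ A) a' a :=
    joinedIn_far hA ha'N ha (Or.inl ⟨by rw [ha'5]; linarith [le_max_left R R₀], by linarith⟩)
  have h2 : JoinedIn (({z : EuclideanSpace ℝ (Fin 6) | ∑ i : Fin 5, z (Fin.castSucc i) ^ 2 = 1} :
      Set (EuclideanSpace ℝ (Fin 6))) \ A) b b' :=
    joinedIn_far hA hb hb'N (Or.inr ⟨by linarith, by rw [hb'5]; linarith [le_max_left R R₀]⟩)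
  exact hR₀ a' b' ha'N hb'N (by rw [ha'5]; linarith [le_max_right R R₀]) (by rw [hb'5]; exact le_max_right R R₀)
    ((h1.trans hJ).trans h2)

/-- Conversely, end-separation follows from the non-joinability of two reference far points
`a, b` (heights `< -B`, `> B`) once `|z₅| ≤ B` on `A`. [folklore] -/
theorem separatesEnds_of_not_joinedIn {A : Set (EuclideanSpace ℝ (Fin 6))} {B : ℝ} (hA : ∀ z ∈ A, |z 5| ≤ B)
    {a b : EuclideanSpace ℝ (Fin 6)}
    (ha : ∑ i : Fin 5, a (Fin.castSucc i) ^ 2 = 1) (hb : ∑ i : Fin 5, b (Fin.castSucc i) ^ 2 = 1)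
    (ha5 : a 5 < -B) (hb5 : B < b 5)
    (hJ : ¬ JoinedIn (({z : EuclideanSpace ℝ (Fin 6) | ∑ i : Fin 5, z (Fin.castSucc i) ^ 2 = 1} :
        Set (EuclideanSpace ℝ (Fin 6))) \ A) a b) :
    SeparatesEnds A := by
  refine ⟨|B| + 1, fun a' b' ha' hb' ha'5 hb'5 hJ' => hJ ?_⟩
  have h1 : JoinedIn (({z : EuclideanSpace ℝ (Fin 6) | ∑ i : Fin 5, z (Fin.castSucc i) ^ 2 = 1} :
      Set (EuclideanSpace ℝ (Fin 6))) \ A) a a' :=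
    joinedIn_far hA ha ha' (Or.inl ⟨ha5, by linarith [le_abs_self B]⟩)
  have h2 : JoinedIn (({z : EuclideanSpace ℝ (Fin 6) | ∑ i : Fin 5, z (Fin.castSucc i) ^ 2 = 1} :
      Set (EuclideanSpace ℝ (Fin 6))) \ A) b' b :=
    joinedIn_far hA hb' hb (Or.inr ⟨by linarith [le_abs_self B], hb5⟩)
  exact (h1.trans hJ').trans h2

variable {M : Type} [TopologicalSpace M] [ChartedSpace (EuclideanSpace ℝ (Fin 4)) M]
  [IsManifold (𝓡 4) ∞ M]

variable {F : ℝ → M → EuclideanSpace ℝ (Fin 6)} {ν : ℝ → M → EuclideanSpace ℝ (Fin 6)} {T : ℝ}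

/-- **Height bound on a compact time slab**: `|F(s, x)₅| ≤ B` for `s ∈ [T, t + 1]`, `x ∈ M`.
[folklore] -/
theorem cylFlow_height_bound [CompactSpace M] (h : IsCylinderMCF M F ν T) (t : ℝ) :
    ∃ B : ℝ, ∀ s ∈ Icc T (t + 1), ∀ x : M, |F s x 5| ≤ B := by
  obtain ⟨U, hU, hTU, hF⟩ := h.contMDiffOn
  have hK : IsCompact (Icc T (t + 1) ×ˢ (univ : Set M)) := isCompact_Icc.prod isCompact_univ
  have hsub : Icc T (t + 1) ×ˢ (univ : Set M) ⊆ U ×ˢ univ := prod_mono (fun s hs => hTU (mem_Ici.2 hs.1)) subset_rfl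
  have hc : ContinuousOn (fun p : ℝ × M => F p.1 p.2 (5 : Fin 6)) (Icc T (t + 1) ×ˢ (univ : Set M)) :=
    ((EuclideanSpace.proj (5 : Fin 6)).continuous.comp_continuousOn (hF.continuousOn.mono hsub))
  obtain ⟨B, hB⟩ := hK.exists_bound_of_continuousOn hc
  exact ⟨B, fun s hs x => by simpa [Real.norm_eq_abs] using hB (s, x) ⟨hs, mem_univ _⟩⟩

/-- **The set of separating times is closed**: if `tₙ → t` with `tₙ ≥ T` and every `F tₙ (M)`
separates the ends, then so does `F t (M)` — a path in `N ∖ F t (M)` between the far regions is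
compact, at positive distance from the compact slice, hence misses the uniformly close slices
`F tₙ (M)` for `n` large. [folklore] -/
theorem cylFlow_isClosed_separatesEnds [T2Space M] [CompactSpace M] (h : IsCylinderMCF M F ν T) :
    IsClosed {t : ℝ | T ≤ t ∧ SeparatesEnds (range (F t))} := by
  refine IsSeqClosed.isClosed fun u t hu hut => ?_
  have ht : T ≤ t := ge_of_tendsto' hut fun n => (hu n).1
  refine ⟨ht, ?_⟩
  obtain ⟨B, hB⟩ := cylFlow_height_bound h t
  have hBt : ∀ z ∈ range (F t), |z 5| ≤ B := by
    rintro _ ⟨x, rfl⟩; exact hB t ⟨ht, by linarith⟩ x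
  rcases isEmpty_or_nonempty M with hM | hM
  · -- empty `M`: all slices are empty, so the separation of any `F (u n)` is that of `F t`
    refine ⟨|B| + 1, fun a b ha hb ha5 hb5 hJ => ?_⟩
    obtain ⟨n, -⟩ := (hut.eventually (Ioo_mem_nhds (by linarith : t - 1 < t) (by linarith : t < t + 1))).exists
    have hrange : range (F (u n)) = range (F t) := by rw [range_eq_empty, range_eq_empty]
    have hBn : ∀ z ∈ range (F (u n)), |z 5| ≤ B := by rw [hrange]; exact hBt
    refine not_joinedIn_of_separatesEnds hBn (hu n).2 (by linarith [le_abs_self B] : B < |B| + 1) ha hb ha5 hb5 ?_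
    rw [hrange]; exact hJ
  obtain ⟨x₀⟩ := hM
  haveI : Nonempty M := ⟨x₀⟩
  -- reference far points
  have hp₀ : ∑ i : Fin 5, (truncL (F t x₀)) i ^ 2 = 1 := by simpa [truncL_apply] using h.mem_cyl t ht x₀
  set a : EuclideanSpace ℝ (Fin 6) := padL (truncL (F t x₀)) + (-(|B| + 1)) • (axis : EuclideanSpace ℝ (Fin 6)) with ha
  set b : EuclideanSpace ℝ (Fin 6) := padL (truncL (F t x₀)) + (|B| + 1) • (axis : EuclideanSpace ℝ (Fin 6)) with hb
  have haN : ∑ i : Fin 5, a (Fin.castSucc i) ^ 2 = 1 := vert_mem_Ncyl hp₀ _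
  have hbN : ∑ i : Fin 5, b (Fin.castSucc i) ^ 2 = 1 := vert_mem_Ncyl hp₀ _
  have ha5 : a 5 = -(|B| + 1) := vert_apply_five _ _
  have hb5 : b 5 = |B| + 1 := vert_apply_five _ _
  refine separatesEnds_of_not_joinedIn hBt haN hbN (by rw [ha5]; linarith [le_abs_self B])
    (by rw [hb5]; linarith [le_abs_self B]) fun hJ => ?_
  -- a path at positive distance from the compact slice
  obtain ⟨γ, hγ⟩ := hJ
  have hKc : IsCompact (range γ) := isCompact_range γ.continuous
  have hSc : IsClosed (range (F t)) := (isCompact_range (h.isSmoothEmbedding t ht).contMDiff.continuous).isClosed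
  obtain ⟨d, hd, hdle⟩ := hKc.exists_forall_le' (continuous_infDist_pt (range (F t))).continuousOn (a := 0)
    (by
      rintro _ ⟨τ, rfl⟩
      rw [← hSc.notMem_iff_infDist_pos (range_nonempty _)]
      exact (hγ τ).2)
  -- slices close to `F t` miss the path
  obtain ⟨θ, hθ, hclose⟩ := cylFlow_uniform_close h ht hd
  obtain ⟨n, hn⟩ := (hut.eventually (Metric.ball_mem_nhds t (lt_min hθ one_pos))).exists
  have hn' : |u n - t| < min θ 1 := by rw [← Real.dist_eq]; exact hn
  obtain ⟨hn1, hn2⟩ := lt_min_iff.1 hn' 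
  have hJn : JoinedIn (({z : EuclideanSpace ℝ (Fin 6) | ∑ i : Fin 5, z (Fin.castSucc i) ^ 2 = 1} :
      Set (EuclideanSpace ℝ (Fin 6))) \ range (F (u n))) a b := by
    refine ⟨γ, fun τ => ⟨(hγ τ).1, ?_⟩⟩
    rintro ⟨x, hx⟩
    have h1 : d ≤ infDist (γ τ) (range (F t)) := hdle _ ⟨τ, rfl⟩
    have h2 : infDist (γ τ) (range (F t)) ≤ dist (γ τ) (F t x) := infDist_le_dist_of_mem ⟨x, rfl⟩
    have h3 : ‖F (u n) x - F t x‖ < d := hclose (u n) (hu n).1 hn1 x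
    rw [← hx, dist_eq_norm] at h2
    rw [← hx] at h1
    linarith
  have hBn : ∀ z ∈ range (F (u n)), |z 5| ≤ B := by
    rintro _ ⟨x, rfl⟩
    refine hB (u n) ⟨(hu n).1, ?_⟩ x
    have := abs_lt.1 hn2; linarith
  exact not_joinedIn_of_separatesEnds hBn (hu n).2 (by linarith [le_abs_self B] : B < |B| + 1) haN hbN
    (by rw [ha5]) (by rw [hb5]) hJn

end Ends

/-- Marker of this part (registered sub-goal `helper_sepPersistsHorizontal` of stmt-SmoothPoincare4-7632): two points of `N` at the same height are joined inside their sphere slice (`joinedIn_horizontal`). [folklore] -/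
theorem helper_sepPersistsHorizontal :
    ∀ (p q : EuclideanSpace ℝ (Fin 5)), (∑ i : Fin 5, p i ^ 2 = 1) → (∑ i : Fin 5, q i ^ 2 = 1) → ∀ c : ℝ, JoinedIn {z : EuclideanSpace ℝ (Fin 6) | (∑ i : Fin 5, z (Fin.castSucc i) ^ 2 = 1) ∧ z 5 = c} (Literature.Geometry.Manifold.CylinderSlice.padL p + c • Literature.Geometry.Manifold.CylinderSlice.axis) (Literature.Geometry.Manifold.CylinderSlice.padL q + c • Literature.Geometry.Manifold.CylinderSlice.axis) :=
  fun _ _ hp hq c => joinedIn_horizontal hp hq c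

end Summit.SmoothPoincare4.SmoothPoincare4.Theorems.CylinderEntropySliceIsolation
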